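import Literature.AlgebraicGeometry.Motives.SurfaceNet
import Literature.AlgebraicGeometry.Motives.SegreEmbedding
import Literature.AlgebraicGeometry.Motives.VarietiesProjectiveSpaceProofs
import HarnessLib

/-!
# Product nets: `F × ℙᵐ → ℙᵐ` is a net of `r`-folds (non-vacuity of `FiberNet` / `SurfaceNet`)

Topic `Literature/AlgebraicGeometry/Motives`. The simplest honest inhabitants of the structures
`Literature.AlgebraicGeometry.Motives.FiberNet r m X` and `SurfaceNet m X` of `Motives/SurfaceNet`:
for a smooth projective geometrically irreducible `r`-fold `F` over a field `k`, the second
projection `pr₂ : F ×ₖ ℙᵐ → ℙᵐ` is a fibration of the smooth projective `(m + r)`-fold `F ×ₖ ℙᵐ`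
(products of smooth projective varieties are smooth projective, Segre: the tree's
`IsSmoothProjective.tensor_holds`; `ℙᵐ` is smooth projective, `isSmoothProjective_projectiveSpace_holds`)
with geometrically connected fibres (base change of the geometrically irreducible `F → Spec k`) and
smooth of relative dimension `r` EVERYWHERE (base change of `F → Spec k`), hence a net of `r`-folds
on `F ×ₖ ℙᵐ` itself through the tautological constructor `FiberNet.ofFibration` (empty base locus,
`σ = 𝟙`). Its discriminant is empty and its smooth base is all of `ℙᵐ`, so every rational fibre is
a smooth projective `r`-fold; with `F = ℙ²` this gives a surface net over `ℙᵐ` for every `m` and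
every field (`SurfaceNet.projectivePlaneProd`).

Also recorded (used here, absent from Mathlib): a geometrically irreducible morphism is
geometrically connected (`geometricallyConnected_of_geometricallyIrreducible`; irreducible spaces
are connected).

## References

* R. Hartshorne, *Algebraic Geometry* (1977), III Prop. 10.1 (b) (smooth morphisms are stable
  under base change), II Ex. 4.9 (Segre: products of projective varieties are projective).
  [Hartshorne1977]
* The Stacks Project, Tag 038F (geometric irreducibility and products), Tag 0363 ff.
  (geometrically connected schemes). [StacksProject]
-/

universe u

open CategoryTheory AlgebraicGeometry Limits MonoidalCategory CartesianMonoidalCategory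

noncomputable section

namespace Literature.AlgebraicGeometry.Motives

variable {k : Type u} [Field k]

/-- A geometrically irreducible morphism is geometrically connected: every base change to a field
is an irreducible, hence connected, scheme (Mathlib `GeometricallyIrreducible`,
`GeometricallyConnected`). [folklore] -/
theorem geometricallyConnected_of_geometricallyIrreducible {Y Z : Scheme.{u}} (f : Y ⟶ Z)
    [h : GeometricallyIrreducible f] : GeometricallyConnected f :=
  ⟨fun K _ y W fst snd sq => by
    haveI : IrreducibleSpace W := h.geometrically_irreducibleSpace y fst snd sq
    infer_instance⟩

section Product

variable {r : ℕ} (m : ℕ) (F : SchemeOver k) (hF : IsSmoothProjective r F)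

/-- The fibre square of `F ×ₖ ℙᵐ` (the cartesian product in `Over (Spec k)` is the pullback).
[folklore] -/
theorem isPullback_fst_snd_projectiveSpace :
    IsPullback (fst F (projectiveSpace m k)).left (snd F (projectiveSpace m k)).left F.hom
      (projectiveSpace m k).hom :=
  IsPullback.of_hasPullback F.hom (projectiveSpace m k).hom

/-- `pr₂ : F ×ₖ ℙᵐ → ℙᵐ` is geometrically irreducible when `F` is (base change of `F → Spec k`).
[cite: StacksProject, Tag 038F] -/
theorem geometricallyIrreducible_snd_left [GeometricallyIrreducible F.hom] :
    GeometricallyIrreducible (snd F (projectiveSpace m k)).left :=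
  MorphismProperty.of_isPullback (P := @GeometricallyIrreducible)
    (isPullback_fst_snd_projectiveSpace m F) ‹_›

/-- `pr₂ : F ×ₖ ℙᵐ → ℙᵐ` is smooth of relative dimension `r` when `F → Spec k` is (base change,
Hartshorne III Prop. 10.1 (b)). [cite: Hartshorne1977, III Prop. 10.1 (b)] -/
theorem smoothOfRelativeDimension_snd_left [SmoothOfRelativeDimension r F.hom] :
    SmoothOfRelativeDimension r (snd F (projectiveSpace m k)).left :=
  haveI := smoothOfRelativeDimension_isStableUnderBaseChange (n := r)
  MorphismProperty.of_isPullback (P := @SmoothOfRelativeDimension r)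
    (isPullback_fst_snd_projectiveSpace m F) ‹_›

/-- **The product net.** For a smooth projective geometrically irreducible `r`-fold `F`, the second
projection `F ×ₖ ℙᵐ → ℙᵐ` is a net of `r`-folds on the smooth projective `(m + r)`-fold `F ×ₖ ℙᵐ`
(tautological net `FiberNet.ofFibration`: total space `F ×ₖ ℙᵐ`, `σ = 𝟙`, empty base locus).
[folklore] -/
def FiberNet.prodNet : FiberNet r m (F ⊗ projectiveSpace m k) :=
  haveI := hF.geometricallyIrreducible
  haveI := hF.smoothOfRelativeDimension
  haveI : GeometricallyConnected (snd F (projectiveSpace m k)).left :=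
    haveI := geometricallyIrreducible_snd_left m F
    geometricallyConnected_of_geometricallyIrreducible _
  FiberNet.ofFibration
    (by simpa only [Nat.add_comm] using
      IsSmoothProjective.tensor_holds hF (isSmoothProjective_projectiveSpace_holds k m))
    (snd F (projectiveSpace m k))
    (fun U _ => by
      haveI := smoothOfRelativeDimension_isStableUnderBaseChange (n := r)
      exact MorphismProperty.of_isPullback (P := @SmoothOfRelativeDimension r)
        (isPullback_morphismRestrict (snd F (projectiveSpace m k)).left U).flip
        (smoothOfRelativeDimension_snd_left m F))

/-- The product net lives on `F ×ₖ ℙᵐ` itself. [folklore] -/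
@[simp] theorem FiberNet.prodNet_total : (FiberNet.prodNet m F hF).total = F ⊗ projectiveSpace m k := rfl

/-- Its projection is `pr₂`. [folklore] -/
@[simp] theorem FiberNet.prodNet_proj : (FiberNet.prodNet m F hF).proj = snd F (projectiveSpace m k) := rfl

/-- Its blow-down is the identity. [folklore] -/
@[simp] theorem FiberNet.prodNet_blowDown : (FiberNet.prodNet m F hF).blowDown = 𝟙 _ := rfl

/-- Its base locus is empty. [folklore] -/
@[simp] theorem FiberNet.prodNet_baseLocus : (FiberNet.prodNet m F hF).baseLocus = ∅ := rfl

/-- `pr₂ : F ×ₖ ℙᵐ → ℙᵐ` is smooth. [cite: Hartshorne1977, III Prop. 10.1 (b)] -/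
theorem FiberNet.smooth_proj_prodNet : Smooth (FiberNet.prodNet m F hF).proj.left := by
  haveI := hF.smoothOfRelativeDimension
  haveI : SmoothOfRelativeDimension r (snd F (projectiveSpace m k)).left :=
    smoothOfRelativeDimension_snd_left m F
  change Smooth (snd F (projectiveSpace m k)).left
  exact SmoothOfRelativeDimension.smooth r (snd F (projectiveSpace m k)).left

/-- The discriminant of the product net is empty … [folklore] -/
@[simp] theorem FiberNet.discriminant_prodNet : (FiberNet.prodNet m F hF).discriminant = ∅ :=
  (FiberNet.discriminant_eq_empty_iff _).mpr (FiberNet.smooth_proj_prodNet m F hF)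

/-- … and its smooth base is all of `ℙᵐ`. [folklore] -/
@[simp] theorem FiberNet.smoothBase_prodNet : (FiberNet.prodNet m F hF).smoothBase = ⊤ :=
  (FiberNet.smoothBase_eq_top_iff _).mpr (FiberNet.smooth_proj_prodNet m F hF)

/-- Hence every rational fibre of the product net is a smooth projective geometrically irreducible
`r`-fold (it is `F ×ₖ Spec k ≅ F`). [folklore] -/
theorem FiberNet.isSmoothProjective_fiber_prodNet (b : AlgPoints (projectiveSpace m k) k) :
    IsSmoothProjective r ((FiberNet.prodNet m F hF).fiber b) :=
  FiberNet.isSmoothProjective_fiber_of_mem_smoothBase _ b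
    (by rw [FiberNet.smoothBase_prodNet]; trivial)

end Product

/-- **Surface nets exist over every `ℙᵐ_k`**: for a smooth projective geometrically irreducible
surface `S`, `pr₂ : S ×ₖ ℙᵐ → ℙᵐ` is a surface net on the `(m + 2)`-fold `S ×ₖ ℙᵐ`. [folklore] -/
abbrev SurfaceNet.prodNet (m : ℕ) (S : SchemeOver k) (hS : IsSmoothProjective 2 S) :
    SurfaceNet m (S ⊗ projectiveSpace m k) :=
  FiberNet.prodNet m S hS

/-- In particular `ℙ² ×ₖ ℙᵐ → ℙᵐ` is a surface net over `ℙᵐ`, for every `m` and every field `k`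
(non-vacuity of `SurfaceNet`). [folklore] -/
def SurfaceNet.projectivePlaneProd (m : ℕ) :
    SurfaceNet m (projectiveSpace 2 k ⊗ projectiveSpace m k) :=
  SurfaceNet.prodNet m (projectiveSpace 2 k) (isSmoothProjective_projectiveSpace_holds k 2)

/-- Every rational fibre of `ℙ² ×ₖ ℙᵐ → ℙᵐ` is a smooth projective surface (a copy of `ℙ²`).
[folklore] -/
theorem SurfaceNet.isSmoothProjective_fiber_projectivePlaneProd (m : ℕ)
    (b : AlgPoints (projectiveSpace m k) k) :
    IsSmoothProjective 2 ((SurfaceNet.projectivePlaneProd (k := k) m).fiber b) :=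
  FiberNet.isSmoothProjective_fiber_prodNet m (projectiveSpace 2 k)
    (isSmoothProjective_projectiveSpace_holds k 2) b

end Literature.AlgebraicGeometry.Motives

end
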